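import Summits.QuantumFields.YangMills.Theorems.BalabanUVNodesN15KingModelSlicesDatumHolder
import HarnessLib

/-!
# BalabanUVNodes ∕ N15 — THE KING-MODEL RUNG, CURVED EDITION (PART Ρ-g): KING 1986 PROPOSITION 3.7 (3.63)–(3.65) **AT `A = 0`, BY NAME** —
# ★★★ `SlicePropagator.Prop37KingOrder (kingSliceKernels L k e_M M a m²)`: King's genuine slices `G^η_{(j)}`, `0 ≤ j ≤ k − 1`, of the `k`-level `A = 0`
# propagator, on ONE carrier, inhabit the lit-balaban schema in King's quantifier order, uniformly in the level, the volume and the mass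
# (Track A, DAG node N15 = NE2; FAN-OUT v1.1 §N15 s3 «KING-MODEL RUNG … + the one-line statement of what the curved case adds»)

HONEST FRAMING.  Count-neutral (cell `pub-ymgap`, seat `pub-ymgap-dag-n15-e` g17; `--supports stmt-QuantumFields-27366 --as helper` = K3⁸
`SpineGivenEndpointR13SepCoPHV`).  TEMPLATE LITERATURE, `A = 0`: C. King's scalar U(1)-Higgs MODEL on finite tori ([King1986] Prop. 3.7 (3.63)–(3.65) p. 663 —
PRINTED and proved there from Theorem 3.3 and the scaling (2.20); here DECIDED for the tree's objects at `A = 0`, `Ω = T_η`), NOT Bałaban's covariant objects;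
NE2⁺ is NOT PRINTED for those and not proved; NOT a node discharge; nothing continuum ∕ ℝ⁴ ∕ OS ∕ mass-gap ∕ Clay.  0 `sorry`, 0 `def`, standard axioms.
THE DATUM is part Ρ-e's `kingSliceKernels` (`…KingModelSlicesDatum`): sites `T_η = Tor (fine (L^k) M)`, NO bonds (`PEmpty`: (3.64) is the VECTOR-field clause,
empty by type in the scalar model), `dist = |x−y|_{T_η}∕L^k`, `G j = (L^jη)^{2−D}·𝒢_j` (`1 ≤ j < k`, part K's `ksSlice = G_{j+1} − G_j` at the mass `m²(L^jη)²`,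
through `torCongr`), `G 0 = η^{2−D}C^{(0),η}`, `dG = L^k·`forward difference — HONEST SCOPE (the (2.20)∕(2.17) dictionary APPLIED as the definition) is
stated there.  THE SCHEMA is the typer's `King1986/SlicePropagatorStatementsAt.lean` v1.1 (`Prop37PrintedAt α D C δ₀`, `Prop37KingOrder D := ∀ α ∈ (0,1),
∃ C δ₀ > 0, Prop37PrintedAt α D C δ₀` — King's order «0 < α < 1» first: the gradient Hölder clause (3.65)₂ has `C = C(α)` in print AND in the model, this
seat's schema note of 16:48Z 08-28; the family-uniform `Prop37Printed` is NOT claimed).  LETTERS: part Ρ-e `kingSliceKernels_ineq363_pos∕_zero` ((3.63)),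
part Ρ-f `kingSliceKernels_ineq365a` ((3.65)₁, α-uniform) ∕ `kingSliceKernels_ineq365b` ((3.65)₂ at α); (3.64) by `PEmpty.elim`.
* ★★★ **`prop37PrintedAt_king_zeroField`** — for odd `L ≥ 3`, `a > 0`, `m₀² ≥ 0` and EVERY `α ∈ (0, 1)` there are `C, δ₀ > 0` such that for every `k ≥ 1`,
  cube `2L^{e_M}`, mass `0 < m² ≤ m₀²`: `Prop37PrintedAt α (kingSliceKernels L k e_M M a m²) C δ₀`;
* ★★★ **`prop37KingOrder_king_zeroField`** — `Prop37KingOrder (kingSliceKernels L k e_M M a m²)`.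
WHAT THE CURVED CASE ADDS (one line): Prop. 3.7 for `G_(j)(Ω, A)` with a regular background `A ≠ 0` (Def. 3.2), sub-domains `Ω ⊊ T_η` with their boundary
factors, and the contour clause (3.64) for the vector field — [King1986] §4 ∕ [Ba 4]'s content.
Locators: [King1986] (2.17) p.653, (2.20) p.654, (3.62) p.663, Prop. 3.7 (3.63)–(3.65) p.663, (4.42) p.675; [Balaban1983RegularityDecay] Thms (1.9)–(1.10) p.573.
-/

noncomputable section

namespace Summit.QuantumFields.YangMills.BalabanUVNodes.N15KingModelRung.Curved

open Real Finset Matrix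
open Literature.MathematicalPhysics.QuantumFieldTheory.Balaban1983to89.B5Prop11Plancherel (Tor fine unitVec)
open Literature.MathematicalPhysics.QuantumFieldTheory.King1986.Torus (tdistT tdistT_nonneg)
open Literature.MathematicalPhysics.QuantumFieldTheory.King1986.SlicePropagator (SliceKernels Prop37PrintedAt Prop37KingOrder holderDeriv)

variable {d : ℕ} (L : ℕ) [NeZero L]

/-- ★★★ **KING's PROPOSITION 3.7 AT `A = 0`, AT EACH HÖLDER EXPONENT, UNIFORMLY**: for odd `L ≥ 3`, `a > 0`, `m₀² ≥ 0`, and every `0 < α < 1` there are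
`C, δ₀ > 0` with `Prop37PrintedAt α (kingSliceKernels L k e_M M a m²) C δ₀` for EVERY level `k ≥ 1`, cube `M_ν = 2L^{e_M}` and mass `0 < m² ≤ m₀²`.
[cite: King1986, Prop. 3.7 (3.63)–(3.65) p.663, (2.20) p.654] -/
theorem prop37PrintedAt_king_zeroField (hLodd : Odd L) (hL : 2 ≤ L) {a : ℝ} (ha : 0 < a) {m0sq : ℝ} (hm0 : 0 ≤ m0sq) {α : ℝ} (hα0 : 0 < α)
    (hα1 : α < 1) :
    ∃ C δ₀ : ℝ, 0 < C ∧ 0 < δ₀ ∧ ∀ (k eM : ℕ) (hk : 1 ≤ k) (M : Fin (d + 1) → ℕ) [∀ μ, NeZero (M μ)] (hM : ∀ μ, M μ = 2 * L ^ eM)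
      (msq : ℝ), 0 < msq → msq ≤ m0sq → Prop37PrintedAt α (kingSliceKernels L k eM M hM hk a msq) C δ₀ := by
  obtain ⟨Cp, δp, hCp, hδp, Hp⟩ := kingSliceKernels_ineq363_pos (d := d) (L := L) hLodd hL ha hm0
  obtain ⟨Cz, δz, hCz, hδz, Hz⟩ := kingSliceKernels_ineq363_zero (d := d) (L := L) hLodd hL ha hm0
  obtain ⟨Ca, δa, hCa, hδa, Ha⟩ := kingSliceKernels_ineq365a (d := d) L hLodd hL ha hm0
  obtain ⟨Cb, δb, hCb, hδb, Hb⟩ := kingSliceKernels_ineq365b (d := d) L hLodd hL ha hm0 hα0 hα1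
  have hL0 : (0 : ℝ) < L := by exact_mod_cast Nat.pos_of_ne_zero (NeZero.ne L)
  set C : ℝ := Cp + Cz + Ca + Cb with hCdef
  set δ₀ : ℝ := min (min δp δz) (min δa δb) with hδdef
  have hC : 0 < C := by positivity
  have hδ₀ : 0 < δ₀ := lt_min (lt_min hδp hδz) (lt_min hδa hδb)
  have hcp : Cp ≤ C := by rw [hCdef]; linarith
  have hcz : Cz ≤ C := by rw [hCdef]; linarith
  have hca : Ca ≤ C := by rw [hCdef]; linarith
  have hcb : Cb ≤ C := by rw [hCdef]; linarith
  have hdp : δ₀ ≤ δp := (min_le_left _ _).trans (min_le_left _ _)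
  have hdz : δ₀ ≤ δz := (min_le_left _ _).trans (min_le_right _ _)
  have hda : δ₀ ≤ δa := (min_le_right _ _).trans (min_le_left _ _)
  have hdb : δ₀ ≤ δb := (min_le_right _ _).trans (min_le_right _ _)
  refine ⟨C, δ₀, hC, hδ₀, ?_⟩
  intro k eM hk M _ hM msq hmsq hcap j hj
  change j + 1 ≤ k at hj
  have hLk : (0 : ℝ) < (L : ℝ) ^ k := pow_pos hL0 _
  have hsl : 0 < (kingSliceKernels L k eM M hM hk a msq).slice j := by
    rw [kingSliceKernels_slice]; exact div_pos (pow_pos hL0 _) hLk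
  -- monotonicity of the displayed bound in `(C, δ₀)`
  have hmono : ∀ {Ci δi : ℝ} (e W : ℝ), 0 ≤ W → Ci ≤ C → δ₀ ≤ δi →
      Ci * ((kingSliceKernels L k eM M hM hk a msq).slice j) ^ e * Real.exp (-(δi * ((kingSliceKernels L k eM M hM hk a msq).slice j)⁻¹ * W))
        ≤ C * ((kingSliceKernels L k eM M hM hk a msq).slice j) ^ e * Real.exp (-(δ₀ * ((kingSliceKernels L k eM M hM hk a msq).slice j)⁻¹ * W)) := by
    intro Ci δi e W hW hCi hδi
    refine mul_le_mul (mul_le_mul_of_nonneg_right hCi (Real.rpow_nonneg hsl.le _)) (Real.exp_le_exp.mpr ?_) (Real.exp_nonneg _)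
      (mul_nonneg hC.le (Real.rpow_nonneg hsl.le _))
    have : δ₀ * ((kingSliceKernels L k eM M hM hk a msq).slice j)⁻¹ * W ≤ δi * ((kingSliceKernels L k eM M hM hk a msq).slice j)⁻¹ * W :=
      mul_le_mul_of_nonneg_right (mul_le_mul_of_nonneg_right hδi (inv_nonneg.mpr hsl.le)) hW
    linarith
  have hdist0 : ∀ u v : Tor (fine (L ^ k) M), 0 ≤ (kingSliceKernels L k eM M hM hk a msq).dist u v := fun u v => by
    rw [kingSliceKernels_dist]; exact div_nonneg (tdistT_nonneg _ u v) hLk.le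
  refine ⟨fun x y => ?_, fun x b => (show PEmpty from b).elim, fun x y z hxy => ?_⟩
  · have hW := hdist0 x y
    by_cases hj1 : 1 ≤ j
    · obtain ⟨h1, h2⟩ := Hp k eM hk M hM msq hmsq hcap j hj1 (by omega) x y
      exact ⟨h1.trans (hmono _ _ hW hcp hdp), fun μ => (h2 μ).trans (hmono _ _ hW hcp hdp)⟩
    · obtain ⟨h1, h2⟩ := Hz k eM hk M hM msq hmsq hcap j (by omega) x y
      exact ⟨h1.trans (hmono _ _ hW hcz hdz), fun μ => (h2 μ).trans (hmono _ _ hW hcz hdz)⟩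
  · have hW : 0 ≤ min ((kingSliceKernels L k eM M hM hk a msq).dist x z) ((kingSliceKernels L k eM M hM hk a msq).dist y z) :=
      le_min (hdist0 x z) (hdist0 y z)
    exact ⟨(Ha k eM hk M hM msq hmsq hcap j hj hα0 hα1 x y z hxy).trans (hmono _ _ hW hca hda),
      fun μ => (Hb k eM hk M hM msq hmsq hcap j hj μ x y z hxy).trans (hmono _ _ hW hcb hdb)⟩

/-- ★★★ **KING's PROPOSITION 3.7 AT `A = 0`, BY NAME, IN KING's QUANTIFIER ORDER**: `Prop37KingOrder (kingSliceKernels L k e_M M a m²)` for odd `L ≥ 3`,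
`a > 0`, every level `k ≥ 1`, cube `2L^{e_M}` and mass `0 < m² ≤ m₀²` — King's genuine slices of the `k`-level `A = 0` propagator, on one carrier, inhabit the
lit-balaban schema of [King1986] Proposition 3.7. [cite: King1986, Prop. 3.7 (3.63)–(3.65) p.663] -/
theorem prop37KingOrder_king_zeroField (hLodd : Odd L) (hL : 2 ≤ L) {a : ℝ} (ha : 0 < a) {m0sq : ℝ} (hm0 : 0 ≤ m0sq) {k : ℕ} (hk : 1 ≤ k) (eM : ℕ)
    (M : Fin (d + 1) → ℕ) [∀ μ, NeZero (M μ)] (hM : ∀ μ, M μ = 2 * L ^ eM) {msq : ℝ} (hmsq : 0 < msq) (hcap : msq ≤ m0sq) :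
    Prop37KingOrder (kingSliceKernels L k eM M hM hk a msq) := by
  intro α hα0 hα1
  obtain ⟨C, δ₀, _, hδ₀, H⟩ := prop37PrintedAt_king_zeroField (d := d) L hLodd hL ha hm0 hα0 hα1
  exact ⟨C, δ₀, hδ₀, H k eM hk M hM msq hmsq hcap⟩

end Summit.QuantumFields.YangMills.BalabanUVNodes.N15KingModelRung.Curved

end
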